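import Mathlib
import HarnessLib
import Literature.Analysis.FluidPDE.QuantitativeShellsOfRegularity
import Literature.Analysis.FluidPDE.DivFreeDriftPositivityPropagation
import Summits.NavierStokesRegularity.NavierStokesRegularity.Theses.AxisTwistDoor

/-!
# Route `AxisTwistDoor`, crux `AveragedConeLiouville` (stmt-NavierStokesRegularity-26889) — the typed substrate of the
# line `lrt_shell` (skeleton of record `Cruxes/AveragedConeLiouville/Lines/lrt_shell.lean`, LEAD ns-atd-p1 g0)

The registered stub signatures of the crux skeleton (v2, a merge of the planner's re-cut `AveragedConeLiouville_birth_v2`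
with the LEAD's Lei–Ren–Tian split) are the NAMES `StubZoomToSlackFree`, `StubCircleSwirl` (planner texts verbatim),
`CircleToolkit`, `ShellFact`, `PositivityPropagationFact`, `FluxDecayFromShell`, `RegularOfFluxDecay`, built on the cylindrical vocabulary about the
vertical axis through the apex (`e3`, `cylPt`, `eR`, `eT`, the circle functionals `circ` = axis circulation
`Γ(r,z,s) = ∮_{S(r,z)} v·e_θ dl`, `vortCirc = ∮ω₃ dl`, `radVortCirc = ∮ω_r dl`, `tiltCirc = ∮|ω_h| dl`, LRT's
`circleTerm = ∮(v_r ω₃ − ω_r v₃) dl`, the planner's `meanR`, `meanZ`, `remainder`, `CircleSwirlEquation`) and the named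
hypothesis blocks `InClass` (the route's energy class), `SignE3` (crux text verbatim), `GlobalCone` (the slack-free cone of
the zoomed profile), `FluxDecay`.  This file fixes that vocabulary ONCE in the tree, with the texts of
the skeleton VERBATIM, so that the stub theorems (`stub_circleToolkit : CircleToolkit`, …) can be landed BY NAME in
`Theorems/AxisTwistDoorAveragedConeLiouville*.lean` files (CONVENTIONS: definitions a line posits live in a reviewed
`…Defs` file, never inside a proof file).

The line is Lei–Ren–Tian, arXiv:2501.08976, §4 (eqs. Gamma-30, Gamma-34, Gamma-sigma-iter) transplanted to the
one-signed, circle-averaged setting of the crux; `ShellFact` and `PositivityPropagationFact` are the two literature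
inputs (LRT Lemma 2.4 = Lei–Ren, Adv. Math. 445 (2024) 109654, cite item wi-87109; LRT Lemma 2.5 = Nazarov–Ural'tseva,
Algebra i Analiz 23 (2011), cite item wi-87110) stated DOWNWARD-SPECIALISED to what the line consumes; they are
hypotheses of the stubs that use them (named-fact stubs in the skeleton), not claims of this file.

WHAT THIS IS NOT: not a statement about Navier–Stokes regularity (Clay A); the door statements are regularity CRITERIA
about HYPOTHETICAL blow-up profiles; vocabulary only — nothing is proved here and no item is closed by this file.
-/

noncomputable section

-- the summit and its single sub-problem share the name (CONVENTIONS §1), as in every Theorems file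
set_option linter.dupNamespace false

namespace Summit.NavierStokesRegularity.NavierStokesRegularity.Theorems.AxisTwistDoorAveragedConeLiouvilleDefs

open scoped BigOperators Topology MeasureTheory InnerProductSpace ENNReal Laplacian
open Filter Set Function MeasureTheory Metric
open Summit.NavierStokesRegularity.NavierStokesRegularity.Theses.AxisTwistDoor
open Literature.Analysis Literature.Analysis.FluidPDE

/-! ### Cylindrical vocabulary about the vertical axis through the apex -/

/-- The vertical direction `e₃ = (0,0,1)`. -/
def e3 : EuclideanSpace ℝ (Fin 3) := EuclideanSpace.single (2 : Fin 3) (1 : ℝ)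

/-- The point with cylindrical coordinates `(r, θ, z)` about the vertical axis through the origin. -/
def cylPt (r θ z : ℝ) : EuclideanSpace ℝ (Fin 3) := WithLp.toLp 2 ![r * Real.cos θ, r * Real.sin θ, z]

/-- The radial unit vector `e_r(θ) = (cos θ, sin θ, 0)`. -/
def eR (θ : ℝ) : EuclideanSpace ℝ (Fin 3) := WithLp.toLp 2 ![Real.cos θ, Real.sin θ, 0]

/-- The azimuthal unit vector `e_θ(θ) = (−sin θ, cos θ, 0)`. -/
def eT (θ : ℝ) : EuclideanSpace ℝ (Fin 3) := WithLp.toLp 2 ![-Real.sin θ, Real.cos θ, 0]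

variable (v : ℝ → EuclideanSpace ℝ (Fin 3) → EuclideanSpace ℝ (Fin 3))

/-- The axis circulation `Γ(r,z,s) = ∮_{S(r,z)} v(s)·e_θ dl = ∫₀^{2π} ⟪v(s)(r cos θ, r sin θ, z), e_θ⟫ r dθ`
(= `∫_{D(r,z)} ω₃` by Stokes; LRT's absolute flux `Γ` in the one-signed case). -/
def circ (r z s : ℝ) : ℝ :=
  ∫ θ in (0 : ℝ)..(2 * Real.pi), ⟪v s (cylPt r θ z), eT θ⟫_ℝ * r

/-- The vertical-vorticity line integral `∮_{S(r,z)} ω₃ dl` (= `∂ᵣΓ`). -/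
def vortCirc (r z s : ℝ) : ℝ :=
  ∫ θ in (0 : ℝ)..(2 * Real.pi), ⟪curl (v s) (cylPt r θ z), e3⟫_ℝ * r

/-- The radial-vorticity line integral `∮_{S(r,z)} ω_r dl` (= `−∂_zΓ`, since `div ω = 0`). -/
def radVortCirc (r z s : ℝ) : ℝ :=
  ∫ θ in (0 : ℝ)..(2 * Real.pi), ⟪curl (v s) (cylPt r θ z), eR θ⟫_ℝ * r

/-- The horizontal-vorticity line integral `∮_{S(r,z)} |ω_h| dl` (the tilt of the vortex lines across the circle). -/
def tiltCirc (r z s : ℝ) : ℝ :=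
  ∫ θ in (0 : ℝ)..(2 * Real.pi), ‖curl (v s) (cylPt r θ z) - ⟪curl (v s) (cylPt r θ z), e3⟫_ℝ • e3‖ * r

/-- LRT's CIRCLE TERM `∮_{S(r,z)} (v_r ω₃ − ω_r v₃) dl` of the disc identity (eq. Gamma-30). -/
def circleTerm (r z s : ℝ) : ℝ :=
  ∫ θ in (0 : ℝ)..(2 * Real.pi),
    (⟪v s (cylPt r θ z), eR θ⟫_ℝ * ⟪curl (v s) (cylPt r θ z), e3⟫_ℝ
      - ⟪curl (v s) (cylPt r θ z), eR θ⟫_ℝ * ⟪v s (cylPt r θ z), e3⟫_ℝ) * r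

/-! ### Planner vocabulary (texts VERBATIM from `AveragedConeLiouville_birth_v2.lean`) -/

/-- circle means of the radial and vertical velocity. -/
noncomputable def meanR (r z s : ℝ) : ℝ :=
  (2 * Real.pi)⁻¹ * ∫ θ in (0 : ℝ)..(2 * Real.pi), ⟪v s (cylPt r θ z), eR θ⟫_ℝ
/-- circle mean of the vertical velocity. -/
noncomputable def meanZ (r z s : ℝ) : ℝ :=
  (2 * Real.pi)⁻¹ * ∫ θ in (0 : ℝ)..(2 * Real.pi), ⟪v s (cylPt r θ z), e3⟫_ℝ

/-- the fluctuation REMAINDER `ℛ(r,z,s) = ∮ [(v_z − v̄_z) ωᵣ − (vᵣ − v̄ᵣ) ω₃] dl` (zero for axisymmetric fields). -/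
noncomputable def remainder (r z s : ℝ) : ℝ :=
  ∫ θ in (0 : ℝ)..(2 * Real.pi),
    ((⟪v s (cylPt r θ z), e3⟫_ℝ - meanZ v r z s) * ⟪Literature.Analysis.FluidPDE.curl (v s) (cylPt r θ z), eR θ⟫_ℝ
      - (⟪v s (cylPt r θ z), eR θ⟫_ℝ - meanR v r z s) * ⟪Literature.Analysis.FluidPDE.curl (v s) (cylPt r θ z), e3⟫_ℝ) * r

/-- the CIRCLE-AVERAGED SWIRL EQUATION with remainder (KNSS's operator `∂ᵣᵣ − r⁻¹∂ᵣ + ∂_zz` on the right), together with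
Stokes' relation `∂ᵣΓ = ∮ω₃ dl`, at every `s < 0`, `r > 0`, `z`. -/
def CircleSwirlEquation : Prop :=
  ∀ s < 0, ∀ r, 0 < r → ∀ z : ℝ,
    deriv (fun r' => circ v r' z s) r = vortCirc v r z s ∧
    deriv (fun s' => circ v r z s') s + meanR v r z s * deriv (fun r' => circ v r' z s) r
        + meanZ v r z s * deriv (fun z' => circ v r z' s) z
      = deriv (fun r' => deriv (fun r'' => circ v r'' z s) r') r - r⁻¹ * deriv (fun r' => circ v r' z s) r
        + deriv (fun z' => deriv (fun z'' => circ v r z'' s) z') z + remainder v r z s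


/-- Statement of STUB 1 (M–L): the circle-averaged swirl identity for energy-class profiles. -/
def StubCircleSwirl : Prop :=
  ∀ (C : ℝ) (v : ℝ → EuclideanSpace ℝ (Fin 3) → EuclideanSpace ℝ (Fin 3)) (π : ℝ → EuclideanSpace ℝ (Fin 3) → ℝ) (H : ℝ → EuclideanSpace ℝ (Fin 3) → EuclideanSpace ℝ (Fin 3) →L[ℝ] EuclideanSpace ℝ (Fin 3)), Literature.Analysis.FluidPDE.HasTypeITimeDecay C v → ContinuousOn (Function.uncurry v) (Set.Iio (0 : ℝ) ×ˢ Set.univ) → (∀ s t : ℝ, s < t → t < 0 → ∀ x, v t x = Literature.Analysis.UnboundedOperators.heatExtension (v s) (t - s) x - Literature.Analysis.FluidPDE.oseenDuhamel 1 s v v t x) → (∀ t < 0, Literature.Analysis.FluidPDE.VectorCalculus.IsDivFree (v t)) → Literature.Analysis.FluidPDE.IsSuitableWeakSolutionOn (Literature.Analysis.FluidPDE.slab (EuclideanSpace ℝ (Fin 3)) (Set.Iio (0 : ℝ)) isOpen_Iio) 1 0 v π → Literature.Analysis.FluidPDE.HasWeakSpatialGradientOn (Literature.Analysis.FluidPDE.slab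 (EuclideanSpace ℝ (Fin 3)) (Set.Iio (0 : ℝ)) isOpen_Iio) v H → Literature.Analysis.FluidPDE.typeIBound (Set.Iio (0 : ℝ) ×ˢ Set.univ) v π H < ⊤ → CircleSwirlEquation v

/-- Statement of STUB 2 (M): zoom to a slack-free (M = 0), globally coned, still-singular class profile. -/
def StubZoomToSlackFree : Prop :=
  ∀ (C : ℝ) (v : ℝ → EuclideanSpace ℝ (Fin 3) → EuclideanSpace ℝ (Fin 3)) (π : ℝ → EuclideanSpace ℝ (Fin 3) → ℝ) (H : ℝ → EuclideanSpace ℝ (Fin 3) → EuclideanSpace ℝ (Fin 3) →L[ℝ] EuclideanSpace ℝ (Fin 3)), Literature.Analysis.FluidPDE.HasTypeITimeDecay C v → ContinuousOn (Function.uncurry v) (Set.Iio (0 : ℝ) ×ˢ Set.univ) → (∀ s t : ℝ, s < t → t < 0 → ∀ x, v t x = Literature.Analysis.UnboundedOperators.heatExtension (v s) (t - s) x - Literature.Analysis.FluidPDE.oseenDuhamel 1 s v v t x) → (∀ t < 0, Literature.Analysis.FluidPDE.VectorCalculus.IsDivFree (v t)) → Literature.Analysis.FluidPDE.IsSuitableWeakSolutionOn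 (Literature.Analysis.FluidPDE.slab (EuclideanSpace ℝ (Fin 3)) (Set.Iio (0 : ℝ)) isOpen_Iio) 1 0 v π → Literature.Analysis.FluidPDE.HasWeakSpatialGradientOn (Literature.Analysis.FluidPDE.slab (EuclideanSpace ℝ (Fin 3)) (Set.Iio (0 : ℝ)) isOpen_Iio) v H → Literature.Analysis.FluidPDE.typeIBound (Set.Iio (0 : ℝ) ×ˢ Set.univ) v π H < ⊤ → (∀ s < 0, ∀ y, 0 ≤ ⟪Literature.Analysis.FluidPDE.curl (v s) y, (EuclideanSpace.single (2 : Fin 3) (1 : ℝ))⟫_ℝ) → (∃ K M : ℝ, 0 ≤ K ∧ 0 ≤ M ∧ ∀ s : ℝ, -1 < s → s < 0 → ∀ r : ℝ, 0 < r → r < 1 → ∀ z : ℝ, |z| < 1 → ∫ θ in (0 : ℝ)..(2 * Real.pi), ‖Literature.Analysis.FluidPDE.curl (v s) (WithLp.toLp 2 ![r * Real.cos θ, r * Real.sin θ, z] : EuclideanSpace ℝ (Fin 3)) - ⟪Literature.Analysis.FluidPDE.curl (v s) (WithLp.toLp 2 ![r * Real.cos θ, r * Real.sin θ, z] : EuclideanSpace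 ℝ (Fin 3)), (EuclideanSpace.single (2 : Fin 3) (1 : ℝ))⟫_ℝ • (EuclideanSpace.single (2 : Fin 3) (1 : ℝ))‖ * r ≤ K * (∫ θ in (0 : ℝ)..(2 * Real.pi), ⟪Literature.Analysis.FluidPDE.curl (v s) (WithLp.toLp 2 ![r * Real.cos θ, r * Real.sin θ, z] : EuclideanSpace ℝ (Fin 3)), (EuclideanSpace.single (2 : Fin 3) (1 : ℝ))⟫_ℝ * r) + M * r) → Literature.Analysis.FluidPDE.IsBackwardSingularPoint v 0 → ∃ (C : ℝ) (v : ℝ → EuclideanSpace ℝ (Fin 3) → EuclideanSpace ℝ (Fin 3)) (π : ℝ → EuclideanSpace ℝ (Fin 3) → ℝ) (H : ℝ → EuclideanSpace ℝ (Fin 3) → EuclideanSpace ℝ (Fin 3) →L[ℝ] EuclideanSpace ℝ (Fin 3)), (Literature.Analysis.FluidPDE.HasTypeITimeDecay C v ∧ ContinuousOn (Function.uncurry v) (Set.Iio (0 : ℝ) ×ˢ Set.univ) ∧ (∀ s t : ℝ, s < t → t < 0 → ∀ x, v t x = Literature.Analysis.UnboundedOperators.heatExtension (v s) (t - s) x -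 Literature.Analysis.FluidPDE.oseenDuhamel 1 s v v t x) ∧ (∀ t < 0, Literature.Analysis.FluidPDE.VectorCalculus.IsDivFree (v t))) ∧ (Literature.Analysis.FluidPDE.IsSuitableWeakSolutionOn (Literature.Analysis.FluidPDE.slab (EuclideanSpace ℝ (Fin 3)) (Set.Iio (0 : ℝ)) isOpen_Iio) 1 0 v π ∧ Literature.Analysis.FluidPDE.HasWeakSpatialGradientOn (Literature.Analysis.FluidPDE.slab (EuclideanSpace ℝ (Fin 3)) (Set.Iio (0 : ℝ)) isOpen_Iio) v H ∧ Literature.Analysis.FluidPDE.typeIBound (Set.Iio (0 : ℝ) ×ˢ Set.univ) v π H < ⊤) ∧ Literature.Analysis.FluidPDE.IsBackwardSingularPoint v 0 ∧ (∀ s < 0, ∀ y, 0 ≤ ⟪Literature.Analysis.FluidPDE.curl (v s) y, (EuclideanSpace.single (2 : Fin 3) (1 : ℝ))⟫_ℝ) ∧ (∃ K : ℝ, 0 ≤ K ∧ ∀ s < 0, ∀ r : ℝ, 0 < r → ∀ z : ℝ, (∫ θ in (0 : ℝ)..(2 * Real.pi), ‖Literature.Analysis.FluidPDE.curl (v s)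 (WithLp.toLp 2 ![r * Real.cos θ, r * Real.sin θ, z] : EuclideanSpace ℝ (Fin 3)) - ⟪Literature.Analysis.FluidPDE.curl (v s) (WithLp.toLp 2 ![r * Real.cos θ, r * Real.sin θ, z] : EuclideanSpace ℝ (Fin 3)), (EuclideanSpace.single (2 : Fin 3) (1 : ℝ))⟫_ℝ • (EuclideanSpace.single (2 : Fin 3) (1 : ℝ))‖ * r) ≤ K * (∫ θ in (0 : ℝ)..(2 * Real.pi), ⟪Literature.Analysis.FluidPDE.curl (v s) (WithLp.toLp 2 ![r * Real.cos θ, r * Real.sin θ, z] : EuclideanSpace ℝ (Fin 3)), (EuclideanSpace.single (2 : Fin 3) (1 : ℝ))⟫_ℝ * r))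

/-! ### The route's energy class and the crux hypotheses, named -/

/-- The route's ENERGY CLASS of profiles (the common hypothesis block of items 26888/26889/26431/26432): Type-I time
rate, continuity on the open lower slab, unit-viscosity Oseen–Duhamel identity between negative times,
divergence-free slices, suitable weak on the backward slab with a weak spatial gradient, Albritton–Barker `𝐈 < ∞`. -/
structure InClass (C : ℝ) (v : ℝ → EuclideanSpace ℝ (Fin 3) → EuclideanSpace ℝ (Fin 3))
    (π : ℝ → EuclideanSpace ℝ (Fin 3) → ℝ)
    (H : ℝ → EuclideanSpace ℝ (Fin 3) → EuclideanSpace ℝ (Fin 3) →L[ℝ] EuclideanSpace ℝ (Fin 3)) : Prop where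
  /-- Type-I rate `‖v(t,x)‖ ≤ C/√(−t)`. -/
  decay : HasTypeITimeDecay C v
  /-- continuity on the open lower slab. -/
  cont : ContinuousOn (Function.uncurry v) (Set.Iio (0 : ℝ) ×ˢ Set.univ)
  /-- the unit-viscosity Oseen–Duhamel identity between negative times. -/
  mild : ∀ s t : ℝ, s < t → t < 0 → ∀ x,
    v t x = UnboundedOperators.heatExtension (v s) (t - s) x - oseenDuhamel 1 s v v t x
  /-- divergence-free slices. -/
  divFree : ∀ t < 0, VectorCalculus.IsDivFree (v t)
  /-- suitable weak solution (ν = 1, f = 0) on the backward slab. -/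
  suitable : IsSuitableWeakSolutionOn (slab (EuclideanSpace ℝ (Fin 3)) (Set.Iio (0 : ℝ)) isOpen_Iio) 1 0 v π
  /-- `H` is a weak spatial gradient of `v` on the slab. -/
  weakGrad : HasWeakSpatialGradientOn (slab (EuclideanSpace ℝ (Fin 3)) (Set.Iio (0 : ℝ)) isOpen_Iio) v H
  /-- Albritton–Barker's Type-I quantity over the lower half space is finite. -/
  typeI : typeIBound (Set.Iio (0 : ℝ) ×ˢ Set.univ) v π H < ⊤

/-- The SIGN hypothesis `ω₃ = ⟪curl v(s), e₃⟫ ≥ 0` everywhere, all `s < 0` (crux text verbatim). -/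
def SignE3 : Prop :=
  ∀ s < 0, ∀ y, 0 ≤ ⟪Literature.Analysis.FluidPDE.curl (v s) y, (EuclideanSpace.single (2 : Fin 3) (1 : ℝ))⟫_ℝ

/-- The GLOBAL SLACK-FREE cone of the zoomed profile: `∮_{S(r,z)}|ω_h| dl ≤ K ∮_{S(r,z)} ω₃ dl` for every `s < 0`,
`r > 0`, `z` (text verbatim = the last conjunct of `StubZoomToSlackFree`). -/
def GlobalCone : Prop :=
  ∃ K : ℝ, 0 ≤ K ∧ ∀ s < 0, ∀ r : ℝ, 0 < r → ∀ z : ℝ, (∫ θ in (0 : ℝ)..(2 * Real.pi), ‖Literature.Analysis.FluidPDE.curl (v s) (WithLp.toLp 2 ![r * Real.cos θ, r * Real.sin θ, z] : EuclideanSpace ℝ (Fin 3)) - ⟪Literature.Analysis.FluidPDE.curl (v s) (WithLp.toLp 2 ![r * Real.cos θ, r * Real.sin θ, z] : EuclideanSpace ℝ (Fin 3)), (EuclideanSpace.single (2 : Fin 3) (1 : ℝ))⟫_ℝ • (EuclideanSpace.single (2 : Fin 3) (1 : ℝ))‖ * r) ≤ K * (∫ θ in (0 : ℝ)..(2 * Real.pi),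 ⟪Literature.Analysis.FluidPDE.curl (v s) (WithLp.toLp 2 ![r * Real.cos θ, r * Real.sin θ, z] : EuclideanSpace ℝ (Fin 3)), (EuclideanSpace.single (2 : Fin 3) (1 : ℝ))⟫_ℝ * r)

/-- FLUX DECAY at the apex: `lim_{ρ→0} sup_{𝒬(ρ)} Γ = 0`, i.e. for every `κ > 0` there is `ρ > 0` with `Γ(r,z,s) < κ`
for `−ρ² < s < 0`, `0 < r < ρ`, `|z| < ρ` (LRT eq. Gamma-decay). -/
def FluxDecay : Prop :=
  ∀ κ : ℝ, 0 < κ → ∃ ρ : ℝ, 0 < ρ ∧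
    ∀ s r z : ℝ, -ρ ^ 2 < s → s < 0 → 0 < r → r < ρ → |z| < ρ → circ v r z s < κ

/-! ### The two NAMED LITERATURE FACTS (hypothesis-stubs until typed under `Literature/`) -/

/-- **Quantitative regular shell for the route's class** (cite item wi-87109: Z. Lei, X. Ren, *Quantitative partial
regularity of the Navier–Stokes equations and applications*, Adv. Math. 445 (2024) 109654, Thm 2 / Prop 9 =
Lei–Ren–Tian arXiv:2501.08976 Lemma 2.4, cylindrical version, SPECIALISED): for every bound `I₀ < ∞` on
Albritton–Barker's `𝐈` there are `δ₀ > 0` and `B` such that every profile of the class with `𝐈 ≤ I₀` has a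
cylindrical shell `{a−δ < r < a+δ, |z| < a+δ}`, `2/3 < a < 4/5`, `δ₀ ≤ δ ≤ 1/10`, on which `|v| + |∇v| ≤ B` for all
times `−(a+δ)² < t < 0` (up to the apex time).  Discharge = Lei–Ren's theorem (`δ ≥ G^{−O(G)}`, bounds `G^{O(G)}`,
`G = ∫_{Q(1)}(|v|³ + |p|^{3/2}) + 2`) + the bridge `G ≤ g(I₀)` after the pressure normalisation `p ↦ p − (p)_B(t)`
(critic L1).
-- TODO(general form): Lei–Ren state it for any suitable weak solution on `Q(1)` with the constant `G`, including
-- `|∇²v| ≤ G^{O(G)}`; only `|v|, |∇v|` on the lateral shell are consumed by this line. -/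
def ShellFact : Prop :=
  ∀ I₀ : ℝ≥0∞, I₀ < ⊤ → ∃ δ₀ B : ℝ, 0 < δ₀ ∧ 0 ≤ B ∧
    ∀ (C : ℝ) (v : ℝ → EuclideanSpace ℝ (Fin 3) → EuclideanSpace ℝ (Fin 3))
      (π : ℝ → EuclideanSpace ℝ (Fin 3) → ℝ)
      (H : ℝ → EuclideanSpace ℝ (Fin 3) → EuclideanSpace ℝ (Fin 3) →L[ℝ] EuclideanSpace ℝ (Fin 3)),
      InClass C v π H → typeIBound (Set.Iio (0 : ℝ) ×ˢ Set.univ) v π H ≤ I₀ →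
        ∃ a δ : ℝ, 2 / 3 < a ∧ a < 4 / 5 ∧ δ₀ ≤ δ ∧ δ ≤ 1 / 10 ∧
          ∀ t : ℝ, -(a + δ) ^ 2 < t → t < 0 →
            ∀ r θ z : ℝ, a - δ < r → r < a + δ → |z| < a + δ →
              ‖v t (cylPt r θ z)‖ ≤ B ∧ ‖fderiv ℝ (v t) (cylPt r θ z)‖ ≤ B

/-- **Propagation of positivity for supersolutions with bounded divergence-free drift** (cite item wi-87110:
A. I. Nazarov, N. N. Ural'tseva, *The Harnack inequality and related properties for the equations with
divergence-free lower-order coefficients*, Algebra i Analiz 23:1 (2011) 136–168 (St. Petersburg Math. J. 23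
(2012) 93–115), Cor. 3.2 = Lei–Ren–Tian arXiv:2501.08976 Lemma 2.5), CLASSICAL special case: for `δ, T > 0`,
`0 < r < 1`, `Λ ≥ 0` there is `β = β(δ,T,r,Λ) > 0` such that every non-negative `C²` supersolution `V` of
`∂ₜV − ΔV + b·∇V = 0` in `B(1) × (0,T) ⊂ ℝ³ × ℝ`, with a `C¹` drift `|b| ≤ Λ`, `div b = 0` there, and with
`|{x ∈ B(1) : V(x, t̄) ≥ λ}| ≥ δ` for some `t̄ ∈ (0, T/3)`, `λ > 0`, satisfies `V ≥ βλ` on `B(r) × (T/2, T)`.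
-- TODO(general form): [NU] allow Lipschitz (weak) supersolutions and `b ∈ L^∞` with `div b = 0` in 𝒟′. -/
def PositivityPropagationFact : Prop :=
  ∀ δ T r Λ : ℝ, 0 < δ → 0 < T → 0 < r → r < 1 → 0 ≤ Λ → ∃ β : ℝ, 0 < β ∧
    ∀ (V : ℝ → EuclideanSpace ℝ (Fin 3) → ℝ) (b : ℝ → EuclideanSpace ℝ (Fin 3) → EuclideanSpace ℝ (Fin 3)),
      ContDiffOn ℝ 2 (Function.uncurry V) (Set.Ioo 0 T ×ˢ Metric.ball (0 : EuclideanSpace ℝ (Fin 3)) 1) →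
      ContDiffOn ℝ 1 (Function.uncurry b) (Set.Ioo 0 T ×ˢ Metric.ball (0 : EuclideanSpace ℝ (Fin 3)) 1) →
      (∀ t ∈ Set.Ioo 0 T, ∀ x ∈ Metric.ball (0 : EuclideanSpace ℝ (Fin 3)) 1, ‖b t x‖ ≤ Λ) →
      (∀ t ∈ Set.Ioo 0 T, ∀ x ∈ Metric.ball (0 : EuclideanSpace ℝ (Fin 3)) 1,
          VectorCalculus.divergence (b t) x = 0) →
      (∀ t ∈ Set.Ioo 0 T, ∀ x ∈ Metric.ball (0 : EuclideanSpace ℝ (Fin 3)) 1, 0 ≤ V t x) →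
      (∀ t ∈ Set.Ioo 0 T, ∀ x ∈ Metric.ball (0 : EuclideanSpace ℝ (Fin 3)) 1,
          0 ≤ deriv (fun τ => V τ x) t - (Δ (V t)) x + ⟪b t x, gradient (V t) x⟫_ℝ) →
      ∀ tbar lam : ℝ, 0 < tbar → tbar < T / 3 → 0 < lam →
        ENNReal.ofReal δ ≤ volume {x : EuclideanSpace ℝ (Fin 3) |
            x ∈ Metric.ball (0 : EuclideanSpace ℝ (Fin 3)) 1 ∧ lam ≤ V tbar x} →
        ∀ t ∈ Set.Ioo (T / 2) T, ∀ x ∈ Metric.ball (0 : EuclideanSpace ℝ (Fin 3)) r, β * lam ≤ V t x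

/-! ### Stub statements (LEAD) -/

/-- STUB 2 statement — the CIRCLE TOOLKIT (everything elementary about the circle functionals that is not the swirl
identity; M, provable now): for a class profile, `Γ = circ v` is `C²` in `(r,z,s)` on `s < 0` and vanishes on the axis,
`∂_zΓ = −∮ω_r dl` (uses `div`-free-ness of NOTHING: it is `∂_z ∮ v·e_θ = ∮ ∂_z v·e_θ` and `ω_r r = ∂_θ v₃ − r ∂_z v_θ`
integrated over the period), and the two ONE-SIDED SHELL INEQUALITY ingredients under the sign `ω₃ ≥ 0`
(LRT p. 11, display before eq. Gamma-34, with the pointwise cone replaced by circle averages): if `|v(s)| ≤ B` on the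
circle `S(r,z)` then `|∮(v_r ω₃ − ω_r v₃) dl| ≤ B(∮ω₃ dl + ∮|ω_h| dl)` and `|Γ(r,z,s)| ≤ 2π r B`. -/
def CircleToolkit : Prop :=
  ∀ (C : ℝ) (v : ℝ → EuclideanSpace ℝ (Fin 3) → EuclideanSpace ℝ (Fin 3))
    (π : ℝ → EuclideanSpace ℝ (Fin 3) → ℝ)
    (H : ℝ → EuclideanSpace ℝ (Fin 3) → EuclideanSpace ℝ (Fin 3) →L[ℝ] EuclideanSpace ℝ (Fin 3)),
    InClass C v π H →
      ContDiffOn ℝ 2 (fun q : ℝ × ℝ × ℝ => circ v q.1 q.2.1 q.2.2) {q | q.2.2 < 0} ∧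
      (∀ s : ℝ, s < 0 → ∀ z : ℝ, circ v 0 z s = 0) ∧
      (∀ s : ℝ, s < 0 → ∀ r : ℝ, 0 < r → ∀ z : ℝ,
        HasDerivAt (fun z' => circ v r z' s) (-radVortCirc v r z s) z) ∧
      (SignE3 v → ∀ s r z B : ℝ, s < 0 → 0 < r → (∀ θ : ℝ, ‖v s (cylPt r θ z)‖ ≤ B) →
        |circleTerm v r z s| ≤ B * (vortCirc v r z s + tiltCirc v r z s) ∧
        |circ v r z s| ≤ 2 * Real.pi * r * B)

/-- STUB 5 statement — FLUX DECAY FROM THE SHELL MECHANISM for the slack-free, globally coned profile (LRT §4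
pp. 11–12: eq. Gamma-34 on `𝒟₁ ∪ 𝒟₂`, positivity propagation for `V = sup Γ − Γ` on the shell, monotonicity of `Γ` in
`r`, the scale contraction eq. Gamma-sigma and its iteration eq. Gamma-sigma-iter), GIVEN the swirl identity, the
toolkit and the two named facts. -/
def FluxDecayFromShell : Prop :=
  StubCircleSwirl → CircleToolkit → ShellFact → PositivityPropagationFact →
    ∀ (C : ℝ) (v : ℝ → EuclideanSpace ℝ (Fin 3) → EuclideanSpace ℝ (Fin 3))
      (π : ℝ → EuclideanSpace ℝ (Fin 3) → ℝ)
      (H : ℝ → EuclideanSpace ℝ (Fin 3) → EuclideanSpace ℝ (Fin 3) →L[ℝ] EuclideanSpace ℝ (Fin 3)),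
      InClass C v π H → SignE3 v → GlobalCone v → FluxDecay v

/-- STUB 6 statement — REGULAR APEX FROM FLUX DECAY (LRT Lemma 3.2 pp. 9–10 run with smallness, p. 12 last
paragraph): flux decay + the global cone give `∫_{D(r,z)}|ω| ≤ (1+K)Γ` small at small scales (`∂ᵣΓ = ∮ω₃ dl` from the
swirl identity), Biot–Savart with a cut-off at the regular shell (cross terms by `ShellFact`) gives critical smallness
of `v`, and ε-regularity makes the apex regular: `(0,0)` is not a backward singular point. -/
def RegularOfFluxDecay : Prop :=
  StubCircleSwirl → CircleToolkit → ShellFact →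
    ∀ (C : ℝ) (v : ℝ → EuclideanSpace ℝ (Fin 3) → EuclideanSpace ℝ (Fin 3))
      (π : ℝ → EuclideanSpace ℝ (Fin 3) → ℝ)
      (H : ℝ → EuclideanSpace ℝ (Fin 3) → EuclideanSpace ℝ (Fin 3) →L[ℝ] EuclideanSpace ℝ (Fin 3)),
      InClass C v π H → SignE3 v → GlobalCone v → FluxDecay v → ¬ IsBackwardSingularPoint v 0

/-! ### v4 of the skeleton (2026-08-28, KEY-NS #116 (1)): the two literature inputs by their TYPED Literature names

The named facts are now the tree's `Literature.Analysis.FluidPDE.LeiRen2024_quantitative_regular_shells_cyl`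
(`QuantitativeShellsOfRegularity.lean`, cite item wi-87109) and
`Literature.Analysis.FluidPDE.NazarovUraltseva2011_positivity_propagation` (`DivFreeDriftPositivityPropagation.lean`,
cite item wi-87110); the line consumes them through two BRIDGE stubs with the statements below.  The classical
positivity-propagation statement consumed by the flux-decay stub is re-cut (`PositivityPropagationFactC`) so that it
FOLLOWS from the typed Nazarov–Ural'tseva fact: the supersolution is `C²` on an open neighbourhood of the CLOSED
cylinder (hence Lipschitz on the cylinder), which the flux-decay stub can always arrange (its cylinders have compact
closure inside the open region `{s < 0, r > 0}` where `Γ` is smooth). -/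

/-- **Classical propagation of positivity, closed-cylinder version** (the special case of Nazarov–Ural'tseva 2011
Cor. 3.2 = Lei–Ren–Tian arXiv:2501.08976 Lemma 2.5 consumed by `stub_fluxDecay`): for `δ, T > 0`, `0 < r < 1`,
`Λ ≥ 0` there is `β = β(δ,T,r,Λ) > 0` such that for every `V`, `b` of class `C²` resp. `C¹` on an open neighbourhood
`U` of the closed cylinder `[0,T] × \overline{B(0,1)} ⊂ ℝ × ℝ³`, with `|b| ≤ Λ` and `div b = 0` on the open cylinder,
`V ≥ 0` and `∂ₜV − ΔV + b·∇V ≥ 0` pointwise on the open cylinder, and `|{x ∈ B(1) : V(t̄,x) ≥ λ}| ≥ δ` for some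
`t̄ ∈ (0,T/3)`, `λ > 0`: `V ≥ βλ` on `(T/2,T) × B(0,r)`. -/
def PositivityPropagationFactC : Prop :=
  ∀ δ T r Λ : ℝ, 0 < δ → 0 < T → 0 < r → r < 1 → 0 ≤ Λ → ∃ β : ℝ, 0 < β ∧
    ∀ (V : ℝ → EuclideanSpace ℝ (Fin 3) → ℝ) (b : ℝ → EuclideanSpace ℝ (Fin 3) → EuclideanSpace ℝ (Fin 3))
      (U : Set (ℝ × EuclideanSpace ℝ (Fin 3))), IsOpen U →
      Set.Icc 0 T ×ˢ Metric.closedBall (0 : EuclideanSpace ℝ (Fin 3)) 1 ⊆ U →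
      ContDiffOn ℝ 2 (Function.uncurry V) U → ContDiffOn ℝ 1 (Function.uncurry b) U →
      (∀ t ∈ Set.Ioo 0 T, ∀ x ∈ Metric.ball (0 : EuclideanSpace ℝ (Fin 3)) 1, ‖b t x‖ ≤ Λ) →
      (∀ t ∈ Set.Ioo 0 T, ∀ x ∈ Metric.ball (0 : EuclideanSpace ℝ (Fin 3)) 1,
          VectorCalculus.divergence (b t) x = 0) →
      (∀ t ∈ Set.Ioo 0 T, ∀ x ∈ Metric.ball (0 : EuclideanSpace ℝ (Fin 3)) 1, 0 ≤ V t x) →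
      (∀ t ∈ Set.Ioo 0 T, ∀ x ∈ Metric.ball (0 : EuclideanSpace ℝ (Fin 3)) 1,
          0 ≤ deriv (fun τ => V τ x) t - (Δ (V t)) x + ⟪b t x, gradient (V t) x⟫_ℝ) →
      ∀ tbar lam : ℝ, 0 < tbar → tbar < T / 3 → 0 < lam →
        ENNReal.ofReal δ ≤ volume {x : EuclideanSpace ℝ (Fin 3) |
            x ∈ Metric.ball (0 : EuclideanSpace ℝ (Fin 3)) 1 ∧ lam ≤ V tbar x} →
        ∀ t ∈ Set.Ioo (T / 2) T, ∀ x ∈ Metric.ball (0 : EuclideanSpace ℝ (Fin 3)) r, β * lam ≤ V t x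

/-- BRIDGE statement (stub `stub_shellOfLeiRen`, M–L): the typed Lei–Ren fact (flat cylinders) implies the
class-specialised `ShellFact` — restriction of the slab-suitable class profile to `𝓠(1)`, the bound
`∫_{𝓠(1)}(|v|³ + |p|^{3/2}) + 2 ≤ g(𝐈)` after the pressure normalisation `p ↦ p − (p)_B(t)` (critic L1), monotonicity of
`G ↦ G^{±MG}`, and identification of the continuous profile with the regular-shell representative on the open lateral
shell (`Measure.eqOn_open_of_ae_eq`). -/
def ShellFactOfLeiRen : Prop :=
  Literature.Analysis.FluidPDE.LeiRen2024_quantitative_regular_shells_cyl → ShellFact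

/-- BRIDGE statement (stub `stub_positivityOfNU`, M–L): the typed Nazarov–Ural'tseva fact on `ℝ³` implies the
classical closed-cylinder version — a `C²` function on a neighbourhood of the compact cylinder is Lipschitz on it, a
pointwise supersolution is a generalized one (integration by parts in `x` against nonnegative Lipschitz test functions
vanishing near the lateral boundary), a `C¹` pointwise divergence-free drift is distributionally divergence-free, and
the drift may be modified off the cylinder to be globally measurable. -/
def PositivityPropagationFactCOfNU : Prop :=
  Literature.Analysis.FluidPDE.NazarovUraltseva2011_positivity_propagation (E := EuclideanSpace ℝ (Fin 3)) →
    PositivityPropagationFactC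

/-- STUB 5 statement, v4 (replaces `FluxDecayFromShell` as the registered signature of `stub_fluxDecay`): FLUX DECAY
FROM THE SHELL MECHANISM for the slack-free, globally coned profile, GIVEN the swirl identity, the toolkit, the
class-specialised shell fact and the CLOSED-cylinder classical positivity propagation. -/
def FluxDecayFromShellC : Prop :=
  StubCircleSwirl → CircleToolkit → ShellFact → PositivityPropagationFactC →
    ∀ (C : ℝ) (v : ℝ → EuclideanSpace ℝ (Fin 3) → EuclideanSpace ℝ (Fin 3))
      (π : ℝ → EuclideanSpace ℝ (Fin 3) → ℝ)
      (H : ℝ → EuclideanSpace ℝ (Fin 3) → EuclideanSpace ℝ (Fin 3) →L[ℝ] EuclideanSpace ℝ (Fin 3)),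
      InClass C v π H → SignE3 v → GlobalCone v → FluxDecay v

end Summit.NavierStokesRegularity.NavierStokesRegularity.Theorems.AxisTwistDoorAveragedConeLiouvilleDefs

end
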